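import Summits.FinalStateConjecture.FinalStateConjecture.Theorems.ClusterCompletenessRecurrentlyFlatDispersesRayCapture
import Literature.Geometry.Lorentzian.CauchyDevelopment
import Literature.Geometry.Lorentzian.VisibleIncompleteNullRay
import Literature.Geometry.Lorentzian.CauchyHypersurfaceCausalProofs
import Literature.Geometry.Lorentzian.GeodesicMaximalFlow
import Literature.Geometry.Lorentzian.NullInfinityConstSmul
import Literature.Geometry.Lorentzian.CorrespondingBoundaryShadow
import Literature.Geometry.Lorentzian.CausalCurveNullGeodesic
import Literature.Geometry.Lorentzian.CausalFutureProofs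
import HarnessLib

/-!
# Future null geodesic completeness ⇒ no event horizon (typed clause of the crux)

Stub `stub_noHorizon_of_futureNullComplete` (W3, logic tier) of the line `birth` for the crux
`HorizonlessMustDrain` of route `BondiDrainDispersal` (item stmt-FinalStateConjecture-9976). The crux
inlines "NO EVENT HORIZON" as: it is false that some event `q` lies outside `I⁻(γ(dom ∩ [0, ∞)))` for
every future-complete normalised null ray `γ` from the data hypersurface (i.e. every event is visible
from infinity, `DataEmbedding.IsVisibleEvent`). We prove this clause in ANY Cauchy development
`𝒟 = (M, g, τ, ι, ν)` (data manifold of dimension `n ≥ 1`) which is not future null geodesically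
incomplete (Hawking–Ellis 1973, §9.2, p. 312; Wald 1984, §12.1, p. 300: `I⁻(𝓘⁺) = M` when no null
geodesic is incomplete). Given an event `q`: (1) some `q' ≫ q` lies in `I⁺(ι X)`
(`exists_mem_chronologicalFuture_range_embed`: off the Cauchy hypersurface `q ∈ I⁺(ι X) ∪ I⁻(ι X)`,
O'Neill 1983, Lemma 14.29, and `I⁺(x) ≠ ∅`); (2) every tangent space carries a future-directed null
vector (`exists_isNull_isFutureDirected`, `dim M ≥ 2`); (3) the maximal geodesic `η` from `q'` with such
a velocity is an endless causal curve (`isEndlessCausalCurve_of_isMaximalGeodesicOn`, from the landed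
brick `RayCapture.isFutureEndless_inter_Ici_of_isMaximalGeodesicOn` of route `ClusterCompleteness` and
its time dual), so it meets `ι(X)` (O'Neill, Lemma 14.29) at a parameter `t₀ < 0` (achronality and
push-up), `η t₀ = ι p`, and `γ t = η (a t + t₀)` with `a = -1 / g(η' t₀, ν p) > 0` is a normalised null
ray from `p`, future complete since a bounded domain would make it a future-incomplete future-directed
null geodesic, with `q' = γ (-t₀ / a)`, `-t₀ / a ≥ 0` (`exists_ray_through_of_mem_chronologicalFuture`);
(4) hence `q ∈ I⁻(q') ⊆ I⁻(γ(dom ∩ [0, ∞)))` (`isVisibleEvent_of_not_isFutureNullGeodesicallyIncomplete`).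
Helper file for the crux (`--supports stmt-FinalStateConjecture-9976`); no definitions, no named facts.

## References

* S. W. Hawking, G. F. R. Ellis, *The large scale structure of space-time*, CUP 1973, §9.2, p. 312;
  §6.2, §8.1. Key `HawkingEllis1973CUP`.
* R. M. Wald, *General Relativity*, University of Chicago Press 1984, §12.1, p. 300. Key `Wald1984GR`.
* B. O'Neill, *Semi-Riemannian geometry with applications to relativity*, Academic Press 1983,
  Ch. 5, Lemma 5.26 (p. 141), Lemma 8 (p. 130); Ch. 14, Cor. 14.1 (p. 402), Lemma 14.29 (p. 415).
  Key `ONeillSemiRiemannian1983`.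
-/

set_option linter.dupNamespace false

noncomputable section

open Set Filter Function
open scoped Manifold ContDiff Topology

open Literature.Geometry.Lorentzian

namespace Summit.FinalStateConjecture.FinalStateConjecture.Theorems
namespace BondiDrainDispersalHorizonlessMustDrain

namespace StubNoHorizonOfFutureNullComplete

/-! ### A future-directed null vector at every point -/

section NullVector

variable {E : Type*} [NormedAddCommGroup E] [NormedSpace ℝ E] {H : Type*} [TopologicalSpace H]
  {I : ModelWithCorners ℝ E H} {n : ℕ∞ω} {M : Type*} [TopologicalSpace M] [ChartedSpace H M]
  [IsManifold I ∞ M]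

/-- **Every tangent space of a time-oriented Lorentzian manifold of dimension `≥ 2` contains a
future-directed null vector**: with `T = τ_x` (timelike) and `e ≠ 0` orthogonal to `T` (spacelike,
O'Neill 1983, Ch. 5, Lemma 5.26), `T + c e` with `c² = -g(T,T)/g(e,e)` is null, and
`g(T, T + c e) = g(T, T) < 0`. [cite: ONeillSemiRiemannian1983, Ch. 5, Lemma 5.26 (p. 141)] -/
theorem exists_isNull_isFutureDirected (g : LorentzianMetric I n M) (τ : TimeOrientation g)
    [FiniteDimensional ℝ E] (hE : 1 < Module.finrank ℝ E) (x : M) :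
    ∃ v : TangentSpace I x, g.IsNull v ∧ τ.IsFutureDirected v := by
  set T : TangentSpace I x := τ.vectorField x with hT_def
  have hT : g.IsTimelike T := τ.isTimelike x
  have hTT : g.val x T T < 0 := hT
  have hT0 : T ≠ 0 := hT.ne_zero
  obtain ⟨y, hy⟩ : ∃ y : TangentSpace I x, LinearIndependent ℝ ![T, y] :=
    exists_linearIndependent_pair_of_one_lt_finrank hE hT0
  set e : TangentSpace I x := y - (g.val x T y / g.val x T T) • T with he_def
  have hTe : g.val x T e = 0 := g.val_orthogonalPart hT y
  have he0 : e ≠ 0 := by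
    intro h
    have h' : (g.val x T y / g.val x T T) • T = y := by
      rw [he_def] at h
      exact (sub_eq_zero.1 h).symm
    exact (LinearIndependent.pair_iff' hT0).1 hy _ h'
  have hee : 0 < g.val x e e := g.pos_of_orthogonal x T e hTT hTe he0
  set c : ℝ := Real.sqrt (-g.val x T T / g.val x e e) with hc_def
  have hc2 : c ^ 2 = -g.val x T T / g.val x e e :=
    Real.sq_sqrt (div_nonneg (neg_nonneg.2 hTT.le) hee.le)
  have heT : g.val x e T = 0 := by rw [g.symm x e T]; exact hTe
  have hvv : g.val x (T + c • e) (T + c • e) = 0 := by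
    have h1 : g.val x (T + c • e) (T + c • e) = g.val x T T + c ^ 2 * g.val x e e := by
      simp only [map_add, map_smul, add_apply, smul_apply, smul_eq_mul, hTe, heT]
      ring
    rw [h1, hc2, div_mul_cancel₀ _ hee.ne']
    ring
  have hTv : g.val x T (T + c • e) = g.val x T T := by
    simp only [map_add, map_smul, smul_eq_mul, hTe, mul_zero, add_zero]
  have hv0 : T + c • e ≠ 0 := fun h0 ↦ by
    have h1 : g.val x T (T + c • e) = 0 := by rw [h0, map_zero]
    linarith
  refine ⟨T + c • e, ⟨hvv, hv0⟩, ⟨hvv.le, hv0⟩, ?_⟩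
  show g.val x T (T + c • e) < 0
  rw [hTv]
  exact hTT

end NullVector

/-! ### Maximal geodesics with nowhere-vanishing velocity are endless in both directions -/

section Endless

variable {E : Type*} [NormedAddCommGroup E] [NormedSpace ℝ E] {H : Type*} [TopologicalSpace H]
  {I : ModelWithCorners ℝ E H} {M : Type*} [TopologicalSpace M] [ChartedSpace H M]
  [IsManifold I ∞ M] [FiniteDimensional ℝ E] [CompleteSpace E] [T2Space M] [I.Boundaryless]
  {cov : CovariantDerivative I E (TangentSpace I : M → Type _)}
  [CovariantDerivative.ContMDiffCovariantDerivative cov 1]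
  [CovariantDerivative.ContMDiffCovariantDerivative cov (⊤ : ℕ∞)]

/-- **A maximal geodesic with nowhere-vanishing velocity has no future endpoint on its whole
domain** (`C^∞` connection, Hausdorff manifold without boundary): its final segment `dom ∩ [t₁, ∞)`
is future endless (`RayCapture.isFutureEndless_inter_Ici_of_isMaximalGeodesicOn`; O'Neill 1983,
Ch. 5, Lemma 8), and a future endpoint only depends on the final segment
(`hasFutureEndpoint_congr_set`). [cite: ONeillSemiRiemannian1983, Ch. 5, Lemma 8 (p. 130)] -/
theorem isFutureEndless_of_isMaximalGeodesicOn {γ : ℝ → M} {dom : Set ℝ}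
    (hγ : IsMaximalGeodesicOn cov γ dom) (hv : ∀ t ∈ dom, velocity I γ t ≠ 0) {t₁ : ℝ}
    (ht₁ : t₁ ∈ dom) : IsFutureEndless γ dom := by
  have h := RecurrentlyFlatDisperses.RayCapture.isFutureEndless_inter_Ici_of_isMaximalGeodesicOn
    hγ hv ht₁
  refine ⟨⟨t₁, ht₁⟩, fun p hp ↦ h.2 p ?_⟩
  exact (hasFutureEndpoint_congr_set (s := dom) (s' := dom ∩ Ici t₁) ht₁ ⟨ht₁, self_mem_Ici⟩
    (fun t ht ↦ ⟨fun h' ↦ ⟨h', mem_Ici.2 ht⟩, fun h' ↦ h'.1⟩) p).1 hp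

/-- **A maximal geodesic with nowhere-vanishing velocity has no past endpoint on its whole domain**:
time dual of `isFutureEndless_of_isMaximalGeodesicOn`, applied to the reversed geodesic
`t ↦ γ (-t)` (a maximal geodesic on `-dom`, `IsMaximalGeodesicOn.comp_mul` with `a = -1`; O'Neill
1983, Ch. 3, Lemma 3.21), via `isFutureEndless_comp_neg_iff`. [cite: ONeillSemiRiemannian1983, Ch. 5, Lemma 8 (p. 130)] -/
theorem isPastEndless_of_isMaximalGeodesicOn {γ : ℝ → M} {dom : Set ℝ}
    (hγ : IsMaximalGeodesicOn cov γ dom) (hv : ∀ t ∈ dom, velocity I γ t ≠ 0) {t₁ : ℝ}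
    (ht₁ : t₁ ∈ dom) : IsPastEndless γ dom := by
  have hβ : IsMaximalGeodesicOn cov (fun t ↦ γ (-1 * t)) ((fun t ↦ (-1 : ℝ) * t) ⁻¹' dom) :=
    hγ.comp_mul (by norm_num)
  have hβv : ∀ t ∈ (fun t ↦ (-1 : ℝ) * t) ⁻¹' dom, velocity I (fun t ↦ γ (-1 * t)) t ≠ 0 := by
    intro t ht
    rw [velocity_comp_mul]
    exact smul_ne_zero (by norm_num) (hv _ ht)
  have ht₁' : -t₁ ∈ (fun t ↦ (-1 : ℝ) * t) ⁻¹' dom := by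
    rw [mem_preimage, neg_one_mul, neg_neg]; exact ht₁
  have hβend : IsFutureEndless (fun t ↦ γ (-1 * t)) ((fun t ↦ (-1 : ℝ) * t) ⁻¹' dom) :=
    isFutureEndless_of_isMaximalGeodesicOn hβ hβv ht₁'
  have hfun : (fun t ↦ γ (-1 * t)) = fun t ↦ γ (-t) := funext fun t ↦ by rw [neg_one_mul]
  have hset : (fun t ↦ (-1 : ℝ) * t) ⁻¹' dom = Neg.neg ⁻¹' dom :=
    Set.ext fun t ↦ by simp only [mem_preimage, neg_one_mul]
  rw [hfun, hset] at hβend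
  exact isFutureEndless_comp_neg_iff.1 hβend

end Endless

/-! ### Null rays of a spacetime are endless causal curves -/

section Spacetime

universe u

variable {d : ℕ} (𝓢 : Spacetime.{u} d) [𝓢.metric.HasLeviCivita]

/-- **A maximal null geodesic of a spacetime is an endless causal curve**: a maximal geodesic of
the Levi-Civita connection on `dom ∋ 0` with future-directed null velocity at `0` is a future causal
curve on the interval `dom` (`RayCapture.nullRay_isFutureCausalCurveOn`) with neither a future nor a
past endpoint (its velocity is null, hence nonzero, throughout) — inextendible null geodesics are
inextendible causal curves (Hawking–Ellis 1973, §6.2, §6.4; O'Neill 1983, Ch. 5, Lemma 8).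
[cite: ONeillSemiRiemannian1983, Ch. 5, Lemma 8 (p. 130)] -/
theorem isEndlessCausalCurve_of_isMaximalGeodesicOn {γ : ℝ → 𝓢.carrier} {dom : Set ℝ}
    (hγ : IsMaximalGeodesicOn 𝓢.metric.leviCivita γ dom) (h0 : (0 : ℝ) ∈ dom)
    (hnull : 𝓢.metric.IsNull (velocity (𝓡 d) γ 0))
    (hfut : 𝓢.timeOrientation.IsFutureDirected (velocity (𝓡 d) γ 0)) :
    𝓢.metric.IsEndlessCausalCurve 𝓢.timeOrientation γ dom := by
  have hk1 : (((1 : ℕ∞) : ℕ∞ω)) + 1 ≤ ∞ := by exact_mod_cast le_top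
  have hkT : (((⊤ : ℕ∞) : ℕ∞ω)) + 1 ≤ ∞ := by exact_mod_cast le_top
  haveI : CovariantDerivative.ContMDiffCovariantDerivative 𝓢.metric.leviCivita 1 :=
    ⟨𝓢.metric.isLocallyContMDiff_leviCivita_holds 1 hk1 univ isOpen_univ⟩
  haveI : CovariantDerivative.ContMDiffCovariantDerivative 𝓢.metric.leviCivita (⊤ : ℕ∞) :=
    ⟨𝓢.metric.isLocallyContMDiff_leviCivita_holds ⊤ hkT univ isOpen_univ⟩
  have hv : ∀ t ∈ dom, velocity (𝓡 d) γ t ≠ 0 := fun t ht ↦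
    (RecurrentlyFlatDisperses.RayCapture.nullRay_velocity 𝓢 hγ h0 hnull hfut ht).1.2
  exact ⟨hγ.2.1, RecurrentlyFlatDisperses.RayCapture.nullRay_isFutureCausalCurveOn 𝓢 hγ h0 hnull hfut,
    isFutureEndless_of_isMaximalGeodesicOn hγ hv h0, isPastEndless_of_isMaximalGeodesicOn hγ hv h0⟩

end Spacetime

/-! ### Cauchy developments: every event below `I⁺(ι X)`; rays through `I⁺(ι X)` -/

section Development

universe u

variable {n : ℕ} {X : Type u} [TopologicalSpace X] [ChartedSpace (EuclideanSpace ℝ (Fin n)) X]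
  [IsManifold (𝓡 n) ∞ X] [ConnectedSpace X] {D : InitialDataSet (𝓡 n) X}

/-- **Above every event of a Cauchy development there is an event of `I⁺(ι X)`**: every `q` has
some `q' ≫ q` with `q' ∈ I⁺(ι X)`. Off the Cauchy hypersurface `q ∈ I⁺(ι X) ∪ I⁻(ι X)`
(`IsCauchyHypersurface.mem_chronologicalFuture_union_chronologicalPast`, O'Neill 1983, Ch. 14,
Lemma 14.29); if `q ∈ ι(X) ∪ I⁺(ι X)` take any `q' ≫ q` (`exists_mem_chronologicalFuture_singleton`,
transitivity of `≪`), and if `q ≪ ι x` take any `q' ≫ ι x`. [cite: ONeillSemiRiemannian1983, Ch. 14, Lemma 29 (p. 415)] -/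
theorem exists_mem_chronologicalFuture_range_embed (𝒟 : CauchyDevelopment D) (q : 𝒟.carrier) :
    ∃ q', q' ∈ 𝒟.metric.chronologicalFuture 𝒟.timeOrientation (range 𝒟.embed) ∧
      q' ∈ 𝒟.metric.chronologicalFuture 𝒟.timeOrientation {q} := by
  have hn2 : (2 : ℕ∞ω) ≤ ∞ := WithTop.coe_le_coe.2 le_top
  by_cases hqS : q ∈ range 𝒟.embed
  · obtain ⟨q', hq'⟩ := LorentzianMetric.exists_mem_chronologicalFuture_singleton
      (g := 𝒟.metric) (τ := 𝒟.timeOrientation) hn2 q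
    exact ⟨q', LorentzianMetric.chronologicalFuture_mono (singleton_subset_iff.2 hqS) hq', hq'⟩
  · rcases 𝒟.isCauchyHypersurface.mem_chronologicalFuture_union_chronologicalPast hn2 hqS with
      hq | hq
    · obtain ⟨q', hq'⟩ := LorentzianMetric.exists_mem_chronologicalFuture_singleton
        (g := 𝒟.metric) (τ := 𝒟.timeOrientation) hn2 q
      exact ⟨q', LorentzianMetric.mem_chronologicalFuture_trans hq hq', hq'⟩
    · obtain ⟨x, hx, μ, a, b, hab, hμ, hμa, hμb⟩ := hq
      have hqx : q ∈ 𝒟.metric.chronologicalPast 𝒟.timeOrientation {x} :=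
        ⟨x, rfl, μ, a, b, hab, hμ, hμa, hμb⟩
      have hxq : x ∈ 𝒟.metric.chronologicalFuture 𝒟.timeOrientation {q} :=
        LorentzianMetric.mem_chronologicalFuture_of_mem_chronologicalPast hqx
      obtain ⟨q', hq'⟩ := LorentzianMetric.exists_mem_chronologicalFuture_singleton
        (g := 𝒟.metric) (τ := 𝒟.timeOrientation) hn2 x
      exact ⟨q', LorentzianMetric.chronologicalFuture_mono (singleton_subset_iff.2 hx) hq',
        LorentzianMetric.mem_chronologicalFuture_trans hxq hq'⟩

/-- **Through every event of `I⁺(ι X)` of a Cauchy development without future-incomplete null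
geodesics passes a future-complete normalised null ray from the data, at a nonnegative parameter.**
For `q' ∈ I⁺(ι X)` the maximal geodesic `η` from `q'` with a future-directed null velocity is an
endless causal curve, so it meets `ι(X)` (O'Neill 1983, Lemma 14.29) at `η t₀ = ι p` with `t₀ < 0`
(else `ι p ∈ J⁺(q') ⊆ I⁺(ι X)`, push-up, against achronality); with `b = g(η' t₀, ν p) < 0` and
`a = -1/b`, `γ t = η (a t + t₀)` is a maximal geodesic with `γ 0 = ι p`, `γ' 0 = a η' t₀` future null,
`g(γ' 0, ν p) = -1`, domain unbounded above (else a future-incomplete future-directed null geodesic),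
and `q' = γ (-t₀ / a)`, `-t₀ / a ≥ 0`. Hawking–Ellis 1973, §9.2, p. 312; Wald 1984, §12.1, p. 300.
[cite: HawkingEllis1973CUP, §9.2, p. 312] -/
theorem exists_ray_through_of_mem_chronologicalFuture (𝒟 : CauchyDevelopment D)
    [𝒟.metric.HasLeviCivita] (hn : 1 ≤ n)
    (hc : ¬ 𝒟.metric.IsFutureNullGeodesicallyIncomplete 𝒟.timeOrientation) {q' : 𝒟.carrier}
    (hq' : q' ∈ 𝒟.metric.chronologicalFuture 𝒟.timeOrientation (range 𝒟.embed)) :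
    ∃ (p : X) (γ : ℝ → 𝒟.carrier) (dom : Set ℝ),
      𝒟.metric.IsNormalisedNullRayFrom 𝒟.timeOrientation 𝒟.embed 𝒟.normal p γ dom ∧
        ¬ BddAbove dom ∧ ∃ s ∈ dom, 0 ≤ s ∧ γ s = q' := by
  -- regularity bookkeeping
  have hn2 : (2 : ℕ∞ω) ≤ ∞ := WithTop.coe_le_coe.2 le_top
  have hn1 : (1 : ℕ∞ω) ≤ ∞ := WithTop.coe_le_coe.2 le_top
  haveI : Fact ((1 : ℕ∞ω) ≤ ∞) := ⟨hn1⟩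
  have hk1 : (((1 : ℕ∞) : ℕ∞ω)) + 1 ≤ ∞ := by exact_mod_cast le_top
  haveI : CovariantDerivative.ContMDiffCovariantDerivative 𝒟.metric.leviCivita 1 :=
    ⟨𝒟.metric.isLocallyContMDiff_leviCivita_holds 1 hk1 univ isOpen_univ⟩
  have hS := 𝒟.isCauchyHypersurface
  have hA : 𝒟.metric.IsAchronal 𝒟.timeOrientation (range 𝒟.embed) :=
    LorentzianMetric.IsCauchyHypersurface.isAchronal_holds hn2 hS
  -- Step 1: a future-directed null vector at `q'` and its maximal geodesic `η`
  have hE : 1 < Module.finrank ℝ (EuclideanSpace ℝ (Fin (n + 1))) := by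
    rw [finrank_euclideanSpace_fin]
    omega
  obtain ⟨v, hv, hv'⟩ := exists_isNull_isFutureDirected 𝒟.metric 𝒟.timeOrientation hE q'
  obtain ⟨η, domη, hη, h0, hη0, hηv, -⟩ :=
    exists_isMaximalGeodesicOn (cov := 𝒟.metric.leviCivita) q' v
  have hnull0 : 𝒟.metric.IsNull (velocity (𝓡 (n + 1)) η 0) := by rw [hηv, hη0]; exact hv
  have hfut0 : 𝒟.timeOrientation.IsFutureDirected (velocity (𝓡 (n + 1)) η 0) := by
    rw [hηv, hη0]; exact hv'
  have hvel : ∀ t ∈ domη, 𝒟.metric.IsNull (velocity (𝓡 (n + 1)) η t) ∧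
      𝒟.timeOrientation.IsFutureDirected (velocity (𝓡 (n + 1)) η t) := fun t ht ↦
    RecurrentlyFlatDisperses.RayCapture.nullRay_velocity 𝒟.toSpacetime hη h0 hnull0 hfut0 ht
  -- Step 2: `η` is an endless causal curve, hence meets the Cauchy hypersurface `ι(X)`
  have hend : 𝒟.metric.IsEndlessCausalCurve 𝒟.timeOrientation η domη :=
    isEndlessCausalCurve_of_isMaximalGeodesicOn 𝒟.toSpacetime hη h0 hnull0 hfut0
  obtain ⟨t₀, ht₀, ht₀S⟩ :=
    LorentzianMetric.IsCauchyHypersurface.exists_mem_of_isEndlessCausalCurve_holds hn2 hS hend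
  obtain ⟨p, hp⟩ := ht₀S
  -- Step 3: `t₀ < 0` (achronality of `ι(X)` and push-up)
  have ht₀neg : t₀ < 0 := by
    by_contra hcon
    have h0t₀ : 0 ≤ t₀ := not_lt.1 hcon
    have hJ : η t₀ ∈ 𝒟.metric.causalFuture 𝒟.timeOrientation {η 0} :=
      RecurrentlyFlatDisperses.RayCapture.nullRay_apply_mem_causalFuture 𝒟.toSpacetime hη h0 hnull0
        hfut0 h0 ht₀ h0t₀
    rw [hη0] at hJ
    obtain ⟨x, hx, μ, a, b, hab, hμ, hμa, hμb⟩ := hq'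
    have hq'x : q' ∈ 𝒟.metric.chronologicalFuture 𝒟.timeOrientation {x} :=
      ⟨x, rfl, μ, a, b, hab, hμ, hμa, hμb⟩
    have h1 : η t₀ ∈ 𝒟.metric.chronologicalFuture 𝒟.timeOrientation {x} :=
      mem_chronologicalFuture_of_mem_causalFuture_of_mem_chronologicalFuture 𝒟.timeOrientation hn1
        hq'x hJ
    exact hA x hx (η t₀) ⟨p, hp⟩ h1
  -- Step 4: the sign of `b = g(η' t₀, ν p)`
  obtain ⟨⟨-, hνunit⟩, hνfut⟩ := 𝒟.isFutureUnitNormal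
  set w : TangentSpace (𝓡 (n + 1)) (𝒟.embed p) := velocity (𝓡 (n + 1)) η t₀ with hw_def
  have hw := hvel t₀ ht₀
  have hwN : 𝒟.metric.IsNull (x := 𝒟.embed p) w := by rw [hp]; exact hw.1
  have hwF : 𝒟.timeOrientation.IsFutureDirected (x := 𝒟.embed p) w := by rw [hp]; exact hw.2
  have hνt : 𝒟.metric.IsTimelike (𝒟.normal p) := by
    show 𝒟.metric.val _ _ _ < 0
    rw [hνunit p]; norm_num
  have hb : 𝒟.metric.val (𝒟.embed p) (𝒟.normal p) w < 0 :=
    (𝒟.timeOrientation.isFutureDirected_iff_val_neg (hνfut p) hνt hwF.1).1 hwF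
  set b : ℝ := 𝒟.metric.val (𝒟.embed p) w (𝒟.normal p) with hb_def
  have hb' : b < 0 := by rw [hb_def, 𝒟.metric.symm]; exact hb
  set a : ℝ := -b⁻¹ with ha_def
  have ha : 0 < a := neg_pos.2 (inv_lt_zero.2 hb')
  have hab : a * b = -1 := by rw [ha_def, neg_mul, inv_mul_cancel₀ hb'.ne]
  -- Step 5: the renormalised ray `γ t = η (a t + t₀)`
  set γ : ℝ → 𝒟.carrier := fun t ↦ η (a * t + t₀) with hγ_def
  set domγ : Set ℝ := (fun t ↦ a * t) ⁻¹' {u | u + t₀ ∈ domη} with hdomγ_def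
  have hγmax : IsMaximalGeodesicOn 𝒟.metric.leviCivita γ domγ := by
    have h1 : IsMaximalGeodesicOn 𝒟.metric.leviCivita (fun t ↦ η (a * t - -t₀)) domγ :=
      (hη.comp_add t₀).comp_mul ha.ne'
    have hfun : (fun t ↦ η (a * t - -t₀)) = γ := funext fun t ↦ by rw [hγ_def, sub_neg_eq_add]
    rw [hfun] at h1; exact h1
  have hmem : ∀ t, t ∈ domγ ↔ a * t + t₀ ∈ domη := fun t ↦ Iff.rfl
  have h0γ : (0 : ℝ) ∈ domγ := by rw [hmem, mul_zero, zero_add]; exact ht₀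
  have hγ0 : γ 0 = 𝒟.embed p := by
    show η (a * 0 + t₀) = 𝒟.embed p
    rw [mul_zero, zero_add]; exact hp.symm
  have hvelγ0 : velocity (𝓡 (n + 1)) γ 0 = a • w := by
    have h1 := velocity_comp_affine (I := 𝓡 (n + 1)) η a t₀ 0
    rw [mul_zero, zero_add] at h1; exact h1
  have hN0 : 𝒟.metric.IsNull (velocity (𝓡 (n + 1)) γ 0) := by
    rw [hvelγ0, hγ0]
    refine ⟨?_, smul_ne_zero ha.ne' hwN.2⟩
    simp only [map_smul, smul_apply, smul_eq_mul, hwN.1, mul_zero]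
  have hF0 : 𝒟.timeOrientation.IsFutureDirected (velocity (𝓡 (n + 1)) γ 0) := by
    rw [hvelγ0, hγ0]
    exact hwF.smul ha
  have hnorm : 𝒟.metric.val (𝒟.embed p) (velocity (𝓡 (n + 1)) γ 0) (𝒟.normal p) = -1 := by
    rw [hvelγ0]
    simp only [map_smul, smul_apply, smul_eq_mul]
    exact hab
  -- Step 6: future completeness of `γ`
  have hnb : ¬ BddAbove domγ := fun hbdd ↦ hc ⟨γ, domγ, hγmax, ⟨0, h0γ⟩, hbdd, fun t ht ↦
    IsGeodesicOn.isNull_and_isFutureDirected_velocity 𝒟.metric 𝒟.timeOrientation hγmax.isOpen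
      hγmax.2.1 hγmax.isGeodesicOn h0γ hN0 hF0 ht⟩
  -- Step 7: `q' = γ (-t₀ / a)`
  have has : a * (-t₀ / a) + t₀ = 0 := by rw [mul_div_cancel₀ _ ha.ne', neg_add_cancel]
  refine ⟨p, γ, domγ, ⟨hγmax, h0γ, hγ0, hN0, hF0, hnorm⟩, hnb, -t₀ / a, ?_,
    div_nonneg (neg_nonneg.2 ht₀neg.le) ha.le, ?_⟩
  · rw [hmem, has]; exact h0
  · show η (a * (-t₀ / a) + t₀) = q'
    rw [has]; exact hη0

/-- **Future null geodesic completeness ⇒ every event is visible from infinity.** In a Cauchy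
development (data manifold of dimension `n ≥ 1`) which is not future null geodesically incomplete,
every event `q` is a visible event (`DataEmbedding.IsVisibleEvent`): pick `q' ≫ q` in `I⁺(ι X)`
(`exists_mem_chronologicalFuture_range_embed`) and a future-complete normalised ray through `q'` at
a nonnegative parameter (`exists_ray_through_of_mem_chronologicalFuture`). Hawking–Ellis 1973, §9.2,
p. 312 (`J⁻(𝓘⁺)`); Wald 1984, §12.1, p. 300. [cite: HawkingEllis1973CUP, §9.2, p. 312] -/
theorem isVisibleEvent_of_not_isFutureNullGeodesicallyIncomplete (𝒟 : CauchyDevelopment D)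
    [𝒟.metric.HasLeviCivita] (hn : 1 ≤ n)
    (hc : ¬ 𝒟.metric.IsFutureNullGeodesicallyIncomplete 𝒟.timeOrientation) (q : 𝒟.carrier) :
    𝒟.toDataEmbedding.IsVisibleEvent q := by
  obtain ⟨q', hq'S, hq'q⟩ := exists_mem_chronologicalFuture_range_embed 𝒟 q
  obtain ⟨p, γ, dom, hγ, hdom, s, hs, hs0, hγs⟩ :=
    exists_ray_through_of_mem_chronologicalFuture 𝒟 hn hc hq'S
  refine ⟨p, γ, dom, hγ, hdom, ?_⟩
  have hqq' : q ∈ 𝒟.metric.chronologicalPast 𝒟.timeOrientation {q'} :=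
    LorentzianMetric.mem_chronologicalPast_of_mem_chronologicalFuture hq'q
  have hmem : q' ∈ γ '' (dom ∩ Ici 0) := ⟨s, ⟨hs, mem_Ici.2 hs0⟩, hγs⟩
  exact LorentzianMetric.chronologicalPast_mono (singleton_subset_iff.2 hmem) hqq'

end Development

end StubNoHorizonOfFutureNullComplete

/-- **W3 — FUTURE NULL GEODESIC COMPLETENESS ⇒ NO EVENT HORIZON (typed clause of the crux
`HorizonlessMustDrain`).** In every Cauchy development `𝒟 = (M, g, τ, ι, ν)` of an initial data set
on a connected `3`-manifold which is not future null geodesically incomplete, it is false that some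
event lies outside the chronological past `I⁻(γ(dom ∩ [0, ∞)))` of every future-complete normalised
null ray `γ` from the data hypersurface: every event is visible from infinity
(`StubNoHorizonOfFutureNullComplete.isVisibleEvent_of_not_isFutureNullGeodesicallyIncomplete`; the
Levi-Civita instance binders are fed with `PseudoRiemannianMetric.hasLeviCivita`). Hawking–Ellis
1973, §9.2, p. 312; Wald 1984, §12.1, p. 300; O'Neill 1983, Ch. 14, Lemma 14.29.
[cite: HawkingEllis1973CUP, §9.2, p. 312] -/
theorem stub_noHorizon_of_futureNullComplete : open scoped Manifold in ∀ (X : Type) [TopologicalSpace X] [ChartedSpace Literature.Geometry.Lorentzian.E3 X] [IsManifold (𝓡 3) ((⊤ : ℕ∞) : WithTop ℕ∞) X] [ConnectedSpace X] (D : Literature.Geometry.Lorentzian.InitialDataSet (𝓡 3) X) (𝒟 : Literature.Geometry.Lorentzian.CauchyDevelopment D), (∀ [𝒟.metric.HasLeviCivita], ¬ 𝒟.metric.IsFutureNullGeodesicallyIncomplete 𝒟.timeOrientation) → ¬ (∀ [𝒟.metric.HasLeviCivita], ∃ q : 𝒟.carrier, ∀ (p : X) (γ : ℝ → 𝒟.carrier)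 (dom : Set ℝ), 𝒟.metric.IsNormalisedNullRayFrom 𝒟.timeOrientation 𝒟.embed 𝒟.normal p γ dom → ¬ BddAbove dom → q ∉ 𝒟.metric.chronologicalPast 𝒟.timeOrientation (γ '' (dom ∩ Set.Ici 0))) := by
  intro X _ _ _ _ D 𝒟 hc hH
  haveI : 𝒟.metric.HasLeviCivita := 𝒟.metric.toPseudoRiemannianMetric.hasLeviCivita
  obtain ⟨q, hq⟩ := hH
  obtain ⟨p, γ, dom, hγ, hdom, hmem⟩ :=
    StubNoHorizonOfFutureNullComplete.isVisibleEvent_of_not_isFutureNullGeodesicallyIncomplete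
      𝒟 (by norm_num) hc q
  exact hq p γ dom hγ hdom hmem

end BondiDrainDispersalHorizonlessMustDrain
end Summit.FinalStateConjecture.FinalStateConjecture.Theorems

end
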